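import Literature.MathematicalPhysics.QuantumFieldTheory.Balaban1983to89.B1Eq324BenfattoSect5BasicLemma
import Literature.MathematicalPhysics.QuantumFieldTheory.Balaban1983to89.B1Eq324CumulantTaylor
import HarnessLib

/-!
# `Balaban1983to89.B1Eq324BenfattoModelEq324` — the d = 3 lane's AS-PRINTED (3.24) binder `B1Sect3Statements.Eq324` INHABITED BY THE MODEL
# [Balaban1982Higgs1] p. 616 CITES: the free field (1.1) and the Hamiltonians (4.5) of [BenfattoEtAl1978], unconditionally — PROVED (two lines
# over the tree theorem `…Sect5BasicLemma.basicLemma_signed` = the Basic Lemma of [2] p. 152 with recorded signs); no new definition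

statement-level companion of a published source with citation tags; every declaration here is a theorem; nothing here is
a claim about the Yang–Mills mass gap

WHY THIS MODULE (cell `pub-ymgap`, seat `dag-n08-d` gen 10, INTENT-44; node N08 [Balaban1985UV3]; the [BenfattoEtAl1978] source chain behind the
(α)-row `h324c`).  The Basic Lemma of [2] p. 152 is now a tree theorem (`…Sect5BasicLemma.basicLemmaPrinted_holds`, seats dag-n08-b, dag-n08-c, dag-n08-d,
2026-08-28), and with it B1's sentence (3.24) for [2]'s model in `η`-currency (`…Sect5BasicLemma.eq324_benfatto_seven/_five` over this seat's
`…Eq324Signed`).  The d = 3 lane (`Summits/QuantumFields/Balaban3D/Proofs/Cumulant324.lean`) carries (3.24) as the BINDER SHAPE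
`B1Sect3Statements.Eq324 lhs cum n̄ C s κ vol := ∃ r, |r| ≤ C·s^κ·vol ∧ lhs = exp(Σ_{n=1}^{n̄} cum n/n! + r)` — «⟨χ exp(V)⟩ = exp[⟨V⟩ + … +
(1/n̄!)⟨V^{n̄}⟩ᵀ + O(εᵏ)|T₁|]».  This file inhabits THAT SHAPE at the model print cites: `lhs = ∫Π_Δχ̂_{p(η)}e^{H_J}dP̂₀` ([2]'s field (1.1) with the
small-field characteristic functions at threshold `p(η) = b₀(1 + log η⁻¹)^{p₀}`), `cum n = ℰ̂₀ᵀ(H_J; n)` (the UNCONDITIONAL Gaussian truncated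
expectations, Remark 1 p. 152), `s = η`, `vol = |I|`, for every truncation order `t` and every `κ < σ(t+1)` (coefficients `≤ c·η^σ`); in
particular `t = 6`, `σ = ½`, `κ = 13/4 > 3` — B1's «e.g. n > 6», [Balaban1985UV3]'s «up to the sixth order».

WHAT IS PROVED (standard axioms; no `sorry`; no definition).
* ★★ `eq324_benfatto_model` — general `t`, `σ`, `κ < σ(t+1)`: `∃ η₀ ∈ (0,1], C ≥ 0, ∀ η ∈ (0, η₀], ∀ s, I ⊇ J ≠ ∅, a` with `coefSup ≤ c·η^σ`:
  `Eq324 (∫Π_Δχ̂_{p(η)}e^{H_J}dP̂₀) (n ↦ ℰ̂₀ᵀ(H_J;n)) t C η κ |I|` — `…Sect5BasicLemma.basicLemma_signed` + `…Eq324Signed.eq324_of_basicLemma_signed` +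
  `…B1Eq324CumulantTaylor.eq324_iff_abs_log_sub_le`.
* `eq324_benfatto_model_seven` (`t = 6`, `σ = ½`, `κ = 13/4`), `eq324_benfatto_model_five` (`t = 4`, `σ = ½`, `κ = 9/4`).
HONEST SCOPE.  The model is [2]'s: nearest-neighbour Gaussian Markov field `P̂₀` on `Q₀ = ℤ^d` of parameters `(α, β)`, Hamiltonians (4.5), thresholds
growing away from `I`, cumulants w.r.t. the unconditional `P̂₀`.  The IDENTIFICATION of [Balaban1982Higgs1]'s / [Balaban1985UV3]'s fluctuation
integrals `∫dμ_{C^{(k)}}(A)χ exp[𝒱(A)]`, their `𝒱`, `ε`/`g_k` and `|T₁^{(k)}|` with an instance of this model («all the assumptions are satisfied»,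
B1 p. 616) is a cluster-expansion-class statement displayed in neither paper and is NOT touched here: this file inhabits the lane's binder
SHAPE at the cited model, not the lane's binder at its carriers (`run3`); count-neutral for N08; `Node00.PrintedUV3V` untouched; nothing about
d = 4, the continuum, OS axioms, a mass gap or the Clay problem.
-/

noncomputable section

open MeasureTheory Finset

namespace Literature.MathematicalPhysics.QuantumFieldTheory.Balaban1983to89.B1Eq324BenfattoModelEq324

open Literature.MathematicalPhysics.QuantumFieldTheory.Balaban1983to89.B1Eq324BenfattoLemma
open Literature.MathematicalPhysics.QuantumFieldTheory.Balaban1983to89.B1Eq324BenfattoEq324Signed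
open Literature.MathematicalPhysics.QuantumFieldTheory.Balaban1983to89.B1Eq324BenfattoSect5BasicLemma
open Literature.MathematicalPhysics.QuantumFieldTheory.Balaban1983to89.B1Eq324CumulantTaylor

variable {d : ℕ} {α β : ℝ}

/-- **THE LANE's (3.24) BINDER SHAPE INHABITED BY [2]'s MODEL, every truncation order.**  For the free field (1.1) of [BenfattoEtAl1978] (`d ≥ 1`,
`α, β > 0`, `E z_Δ² ≤ ½`), every `t`, `D`, `ϰ > 0`, threshold parameters `b₀ > 0`, `p₀ > 2/3`, coupling power `σ > 0`, `c ≥ 0` and every exponent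
`0 < κ < σ(t+1)` there are `η₀ ∈ (0, 1]` and `C ≥ 0` such that for all `η ∈ (0, η₀]`, all `s`, `I ⊇ J`, `I ≠ ∅` and coefficient families with
`sup|coeff| ≤ c·η^σ`:  `⟨Π_Δχ̂_{p(η)} e^{H_J}⟩_{P̂₀} = exp[Σ_{n=1}^{t} ℰ̂₀ᵀ(H_J; n)/n! + r]`, `|r| ≤ C·η^κ·|I|` — i.e.
`B1Sect3Statements.Eq324 (∫Π_Δχ̂_{p(η)}e^{H_J}dP̂₀) (n ↦ ℰ̂₀ᵀ(H_J;n)) t C η κ |I|`.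
[cite: Balaban1982Higgs1, (3.24) p.616; BenfattoEtAl1978, Lemma (4.5)–(4.7) p.152, Remark 1, Remark 4] -/
theorem eq324_benfatto_model (hd : 0 < d) (hα : 0 < α) (hβ : 0 < β) (hvar : freeCov d α β 0 0 ≤ 1 / 2)
    (t D : ℕ) {ϰ : ℝ} (hϰ : 0 < ϰ) {b₀ p₀ σ c κ : ℝ} (hb₀ : 0 < b₀) (hp₀ : 2 / 3 < p₀) (hσ : 0 < σ) (hc : 0 ≤ c) (hκ : 0 < κ)
    (hκσ : κ < σ * (t + 1)) :
    ∃ η₀ C : ℝ, 0 < η₀ ∧ η₀ ≤ 1 ∧ 0 ≤ C ∧ ∀ η : ℝ, 0 < η → η ≤ η₀ →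
      ∀ (s : ℕ) (I J : Finset (Fin d → ℤ)) (a : Coef d), I.Nonempty → J ⊆ I → coefSup s D a J ≤ c * η ^ σ →
        B1Sect3Statements.Eq324 (∫ z, cutoffBoltzmann (hamiltonian s D ϰ a J) I (B10.pFun b₀ p₀ η) z ∂P0 d α β)
          (fun n => truncatedExp (P0 d α β) (hamiltonian s D ϰ a J) n) t C η κ I.card := by
  obtain ⟨η₀, C, hη₀, hη₀1, hC, h⟩ :=
    eq324_of_basicLemma_signed (basicLemma_signed hd hα hβ hvar) t D hϰ hb₀ hp₀ hσ hc hκ hκσ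
  refine ⟨η₀, C, hη₀, hη₀1, hC, fun η hη hηle s I J a hI hJI hA => ?_⟩
  obtain ⟨hpos, habs⟩ := h η hη hηle s I J a hI hJI hA
  rw [eq324_iff_abs_log_sub_le hpos]
  simpa only [cumulantSum] using habs

/-- **d = 3 instance: `t = n̄ = 6`, coefficients `∝ η^{1/2}`, `κ = 13/4 > 3`** — B1's «e.g. n > 6», [Balaban1985UV3] p. 261 «up to the sixth order»:
`Eq324 (∫Π_Δχ̂_{p(η)}e^{H_J}dP̂₀) (n ↦ ℰ̂₀ᵀ(H_J;n)) 6 C η (13/4) |I|` for [2]'s model, unconditionally.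
[cite: Balaban1982Higgs1, (3.24) p.616; Balaban1985UV3, p.261, (24) p.262, (58) p.270; BenfattoEtAl1978, Lemma p.152] -/
theorem eq324_benfatto_model_seven (hd : 0 < d) (hα : 0 < α) (hβ : 0 < β) (hvar : freeCov d α β 0 0 ≤ 1 / 2)
    (D : ℕ) {ϰ : ℝ} (hϰ : 0 < ϰ) {b₀ p₀ c : ℝ} (hb₀ : 0 < b₀) (hp₀ : 2 / 3 < p₀) (hc : 0 ≤ c) :
    ∃ η₀ C : ℝ, 0 < η₀ ∧ η₀ ≤ 1 ∧ 0 ≤ C ∧ ∀ η : ℝ, 0 < η → η ≤ η₀ →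
      ∀ (s : ℕ) (I J : Finset (Fin d → ℤ)) (a : Coef d), I.Nonempty → J ⊆ I →
        coefSup s D a J ≤ c * η ^ (1 / 2 : ℝ) →
        B1Sect3Statements.Eq324 (∫ z, cutoffBoltzmann (hamiltonian s D ϰ a J) I (B10.pFun b₀ p₀ η) z ∂P0 d α β)
          (fun n => truncatedExp (P0 d α β) (hamiltonian s D ϰ a J) n) 6 C η (13 / 4 : ℝ) I.card :=
  eq324_benfatto_model hd hα hβ hvar 6 D hϰ hb₀ hp₀ (by norm_num) hc (by norm_num) (by norm_num)

/-- **d = 2 instance: `t = 4`, coefficients `∝ η^{1/2}`, `κ = 9/4 > 2`**: `Eq324 (∫Π_Δχ̂_{p(η)}e^{H_J}dP̂₀) (n ↦ ℰ̂₀ᵀ(H_J;n)) 4 C η (9/4) |I|` for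
[2]'s model, unconditionally. [cite: Balaban1982Higgs1, (3.24) p.616; BenfattoEtAl1978, Lemma p.152] -/
theorem eq324_benfatto_model_five (hd : 0 < d) (hα : 0 < α) (hβ : 0 < β) (hvar : freeCov d α β 0 0 ≤ 1 / 2)
    (D : ℕ) {ϰ : ℝ} (hϰ : 0 < ϰ) {b₀ p₀ c : ℝ} (hb₀ : 0 < b₀) (hp₀ : 2 / 3 < p₀) (hc : 0 ≤ c) :
    ∃ η₀ C : ℝ, 0 < η₀ ∧ η₀ ≤ 1 ∧ 0 ≤ C ∧ ∀ η : ℝ, 0 < η → η ≤ η₀ →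
      ∀ (s : ℕ) (I J : Finset (Fin d → ℤ)) (a : Coef d), I.Nonempty → J ⊆ I →
        coefSup s D a J ≤ c * η ^ (1 / 2 : ℝ) →
        B1Sect3Statements.Eq324 (∫ z, cutoffBoltzmann (hamiltonian s D ϰ a J) I (B10.pFun b₀ p₀ η) z ∂P0 d α β)
          (fun n => truncatedExp (P0 d α β) (hamiltonian s D ϰ a J) n) 4 C η (9 / 4 : ℝ) I.card :=
  eq324_benfatto_model hd hα hβ hvar 4 D hϰ hb₀ hp₀ (by norm_num) hc (by norm_num) (by norm_num)

end Literature.MathematicalPhysics.QuantumFieldTheory.Balaban1983to89.B1Eq324BenfattoModelEq324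

end
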